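import Summits.QuantumFields.YangMills.Theorems.BalabanUVNodesN13UVRowRFreeAtLiveSelectorRecord13
import Summits.QuantumFields.YangMills.Theorems.BalabanUVNodesN13UVRowOfUpperAndSmallLocus

/-!
# BalabanUVNodes ∕ N13 — THE ENGINES' (UV₁₃) ROW `hUV`, VERBATIM, FROM THREE LEAVES ON THE 𝐓-IMAGE: (U1)ᵀ termwise majorants of the PRE-𝐑 terms
# `χ_k(s)·slotT_k(s)`, (U2) their budget, (L2ˢ)ᵀ the all-small history's lower bound on ITS PRE-𝐑 TERM on the small locus — the 𝐑-free twin of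
# `…N13UVRowOfU1U2L2SmallLocus.hUV₁₃CoPH_of_U1_U2_L2small` (p597573) at every live-selector parameter

Cell `pub-ymgap` (HUMAN RULING D-0062 Track A ∕ D-0149 width), WIDTH SEAT `pub-ymgap-dag-n13-w1` (gen 4, CLAIM-2), key K1⁷ `StabilityBAtRecordR13SepCoPH` =
stmt-QuantumFields-20542 (`--kind proof --supports … --as helper`; count-neutral).  [III] = [Balaban1988Convergent], [IV] = [Balaban1989LargeFieldI],
[B16] = [Balaban1989LargeFieldII], [Av] = [Balaban1985Averaging].

WHY.  p597573 prices N13's child `hUV` of K1⁷ v6 stub 1 (dag-n24-c's 34H §3) at THREE displayed leaves on the record's POST-𝐑 (2.18) representation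
`reprOfRecord₁₃ θ P k` (slot = `slotsOfRecord … k`): (U1) termwise majorants, (U2) their sum `≤ exp(E₊|T|)`, (L2ˢ) the all-small history's lower bound on the small locus.
This seat's `…N13UVRowRFreeAtLiveSelectorRecord13` (p607786) showed that at every LIVE-SELECTOR parameter — all K0∕K1 witnesses `θ₁₅ᶜᶜᴹᵂ = theta13LiveOfNumerics = (…).liveRepin₁₃`
— the post-𝐑 slot is the pre-𝐑 slot times its own (0.3) ratio `∈ {0,1}`: `slot_{k+1} ≤ slotT_{k+1}` everywhere, `=` termwise at every history with empty fibre bond set.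
THIS FILE re-addresses the three leaves to the PRE-𝐑 family `slotsTOfRecord … k` (= def-T's 𝐓-image of level `k−1`, the (2.18) representation `reprTOfRecord₁₃` of
`𝐓ρ_{k−1}`; at level 0 both families are `ρ₀`) and composes the engines' `hUV` binder LETTER FOR LETTER (p595529's `hUV₁₃_of_upper_of_lowerSmallLocus`): so the
K1⁷ lanes may supply N13's (UV₁₃) row with NO statement about def-R's 𝐑-operation — the leaves are statements about [III] §3's 𝐓-image (N11's (S1ᵀ)∕Thm-2 currency).
§1 records that the ALL-SMALL history (last small-field region `Λ_k = univ`) has EMPTY fibre bond set (`Z′ ⊆ Λ_kᶜ = ∅`, def-R's `zpOfSeq_subset`), so (L2ˢ)ᵀ's side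
condition is a one-liner at the consumer's `s₀`.

CONTENTS (theorems only; 0 `def`).  §1 `fibOfSeq_eq_empty_of_Λ_eq_univ`.  §2 (all levels `k`, `θ : Stage13Params` with the selector clause `hsel` and the two ζ-laws):
`slotsOfRecord₁₃_le_slotsT_of_liveSel` · `histTerm₁₃_le_histTermT_of_liveSel` · ★ `densOfRecord₁₃_le_sum_histTermT_of_liveSel` · `histTerm₁₃_eq_histTermT_of_fibOfSeq_eq_empty_of_liveSel`
· `histTermT₁₃_le_densOfRecord₁₃_of_fibOfSeq_eq_empty_of_liveSel`.  §3 `uv₁₃_of_U1T_U2_L2Tsmall_of_liveSel` (one `(P, k)`, numbers `em ep`) · ★★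
`hUV₁₃CoPH_of_U1T_U2_L2Tsmall_of_liveSel` (the engines' binder; `θ : Stage13HParams`, `h : θ.Provisos₁₃CoPH`, `w : WorldP`).

HONEST FRAMING.  Count-neutral by-name composition (p607786 + p595529 + def-R's region geometry); (U1)ᵀ, (U2), (L2ˢ)ᵀ are DISPLAYED — nothing of [B16] Thm 1 ∕
[III] Cor. 3 ∕ Thm 2 claimed; by p607786 §5 an everywhere-(U1)ᵀ at `k ≥ 1` is a statement about the chosen `rnDeriv`∕`condKernel` version (reading only); N13 NOT
discharged; K0⁷∕K1⁷ NOT closed; no stub closed; counts unmoved (typed 28∕28 · discharged 5∕27, A 5∕28); one finite `𝕋⁴_{L^K}` programme at fixed `ε = L^{−K}`; route R4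
closes the CONDITIONAL finite-𝕋⁴ rung `BalabanLadder.UV` only — the Yang–Mills mass gap (Clay) is NOT proved by any of this.  No `sorry`, `def`, `instance`, `notation`.
-/

noncomputable section

open scoped BigOperators Matrix.Norms.L2Operator

namespace Summit.QuantumFields.YangMills.BalabanUVNodes.N13UVRowOfU1TU2L2TSmallLocus

open Literature.MathematicalPhysics.QuantumFieldTheory.Balaban1983to89
open Literature.MathematicalPhysics.QuantumFieldTheory.Balaban1983to89.T4Continuum (T4Family)
open Literature.MathematicalPhysics.QuantumFieldTheory.Balaban1983to89.Node00
open B14.Eq218Concrete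
open FlowStepRuns (genFlow)
open DagBinding (WorldP)
open ExpMeanLog (deltaSU)
open Summit.QuantumFields.YangMills.BalabanUVNodes.N13UVRowRFreeAtLiveSelectorRecord13
  (slotsOfRecord₁₃_succ_le_slotsT_of_liveSel histTerm₁₃_succ_eq_histTermT_of_fibOfSeq_eq_empty_of_liveSel wOfRecord₉_nonneg)
open Summit.QuantumFields.YangMills.BalabanUVNodes.N13UVRowOfUpperAndSmallLocus (hUV₁₃_of_upper_of_lowerSmallLocus uv₁₃_of_upper_of_lowerSmallLocus)

variable {F : T4Family} {N : ℕ} [NeZero N]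

/-! ## §1 The all-small history has EMPTY fibre bond set -/

section Geometry

variable (ν : Stage7Numerics) (τ : TowerNumerics) (p : B12.RunParams) (g : ℕ → ℝ) (k : ℕ)

open Classical in
/-- **A history whose last small-field region is EVERYTHING (`Λ_k = univ`, the all-small history) has EMPTY fibre bond set**: `Z′(s) ⊆ Z_k = Λ_kᶜ = ∅`
(def-R's `zpOfSeq_subset`), and no bond meets the empty set. [cite: Balaban1989LargeFieldI, (0.3) p.176 and p.177 (bookkeeping: `Z′ ⊆ Z`)] -/
theorem fibOfSeq_eq_empty_of_Λ_eq_univ (s : SeqOfRecord F ν τ.M g p.K k) (hΛ : s.Λ k = Set.univ) : fibOfSeq F ν τ p g k s = ∅ := by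
  have hzp : zpOfSeq F ν τ g p.K k s = ∅ := by
    refine Set.subset_empty_iff.mp ?_
    have h := zpOfSeq_subset F ν τ g p.K k s
    rwa [hΛ, Set.compl_univ] at h
  unfold fibOfSeq
  refine Finset.filter_eq_empty_iff.mpr fun b _ hb => ?_
  rw [hzp] at hb
  obtain ⟨x, hx, -⟩ := hb
  exact hx

end Geometry

/-! ## §2 ALL LEVELS `k`: post-𝐑 ≤ pre-𝐑 termwise, `ρ_k ≤ Σ_s χ_k(s)·slotT_k(s)`, equality at empty-fibre histories (level 0: both families ARE `ρ₀`) -/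

section Record

variable (θ : Stage13Params F N)

/-- **`slot_k(s)(V) ≤ slotT_k(s)(V)` at EVERY level** at a live-selector parameter with the ζ-laws: level 0 by `rfl` (both families are `ρ₀`), level `k+1` by p607786.
[cite: Balaban1989LargeFieldI, (0.3) p.176 and p.177 (i)–(ii); Balaban1988Convergent, Thm 1 p.262, (3.24)–(3.25) p.270] -/
theorem slotsOfRecord₁₃_le_slotsT_of_liveSel (hζu : IsZetaUnity F N θ.ν θ.τ9.M θ.ζ) (hζa : IsZetaAbsLeOne F N θ.ν θ.τ9.M θ.ζ)
    (hsel : θ.ppSel = ppSelLiveOfRecord F N θ.ν θ.τ9 (EOfRecord₁₃ F N θ) (wOfRecord₉ F N θ.toStage9Params)) (P : B12.RunParams) :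
    ∀ (k : ℕ) (s : SeqOfRecord F θ.ν θ.τ9.M (gOfRecord₁₃ F N θ P) P.K k) (V : GaugeField (F.P P.K) k (SU N)),
      slotsOfRecord F N θ.ν θ.τ9 (EOfRecord₁₃ F N θ) (wOfRecord₉ F N θ.toStage9Params) θ.ppSel P (gOfRecord₁₃ F N θ P) k s V ≤
        slotsTOfRecord F N θ.ν θ.τ9 (EOfRecord₁₃ F N θ) (wOfRecord₉ F N θ.toStage9Params) θ.ppSel P (gOfRecord₁₃ F N θ P) k s V
  | 0, _, _ => le_rfl
  | k + 1, s, V => slotsOfRecord₁₃_succ_le_slotsT_of_liveSel θ hζu hζa hsel P k s V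

/-- **Termwise, at every level: `χ_k(s)(V)·slot_k(s)(V) ≤ χ_k(s)(V)·slotT_k(s)(V)`** (`χ_k(s) ≥ 0`). [cite: Balaban1988Convergent, (2.18) p.257, (3.24)–(3.25) p.270; Balaban1989LargeFieldI, (0.3) p.176] -/
theorem histTerm₁₃_le_histTermT_of_liveSel (hζu : IsZetaUnity F N θ.ν θ.τ9.M θ.ζ) (hζa : IsZetaAbsLeOne F N θ.ν θ.τ9.M θ.ζ)
    (hsel : θ.ppSel = ppSelLiveOfRecord F N θ.ν θ.τ9 (EOfRecord₁₃ F N θ) (wOfRecord₉ F N θ.toStage9Params)) (P : B12.RunParams) (k : ℕ)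
    (s : SeqOfRecord F θ.ν θ.τ9.M (gOfRecord₁₃ F N θ P) P.K k) (V : GaugeField (F.P P.K) k (SU N)) :
    chiSeqOfRecord F N θ.ν θ.τ9.M (gOfRecord₁₃ F N θ P) P.K k s V *
        slotsOfRecord F N θ.ν θ.τ9 (EOfRecord₁₃ F N θ) (wOfRecord₉ F N θ.toStage9Params) θ.ppSel P (gOfRecord₁₃ F N θ P) k s V ≤
      chiSeqOfRecord F N θ.ν θ.τ9.M (gOfRecord₁₃ F N θ P) P.K k s V *
        slotsTOfRecord F N θ.ν θ.τ9 (EOfRecord₁₃ F N θ) (wOfRecord₉ F N θ.toStage9Params) θ.ppSel P (gOfRecord₁₃ F N θ P) k s V :=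
  mul_le_mul_of_nonneg_left (slotsOfRecord₁₃_le_slotsT_of_liveSel θ hζu hζa hsel P k s V) (chiSeqOfRecord_nonneg F N θ.ν θ.τ9.M _ P.K k s V)

/-- **★ `ρ_k(V) ≤ Σ_s χ_k(s)(V)·slotT_k(s)(V)` AT EVERY LEVEL AND EVERY FIELD** (level 0: equality, both families are `ρ₀`; level `k+1`: the right side is `𝐓ρ_k(V)`,
p607786's `densOfRecord₁₃_succ_le_tdens_of_liveSel`). [cite: Balaban1988Convergent, (2.18) p.257, Thm 1 p.262, (3.24)–(3.25) p.270; Balaban1989LargeFieldI, (0.2)–(0.4) p.176, p.177 (i)–(ii)] -/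
theorem densOfRecord₁₃_le_sum_histTermT_of_liveSel (hζu : IsZetaUnity F N θ.ν θ.τ9.M θ.ζ) (hζa : IsZetaAbsLeOne F N θ.ν θ.τ9.M θ.ζ)
    (hsel : θ.ppSel = ppSelLiveOfRecord F N θ.ν θ.τ9 (EOfRecord₁₃ F N θ) (wOfRecord₉ F N θ.toStage9Params)) (P : B12.RunParams) (k : ℕ)
    (V : GaugeField (F.P P.K) k (SU N)) :
    densOfRecord₁₃ F N θ P k V ≤
      ∑ s : SeqOfRecord F θ.ν θ.τ9.M (gOfRecord₁₃ F N θ P) P.K k, chiSeqOfRecord F N θ.ν θ.τ9.M (gOfRecord₁₃ F N θ P) P.K k s V *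
        slotsTOfRecord F N θ.ν θ.τ9 (EOfRecord₁₃ F N θ) (wOfRecord₉ F N θ.toStage9Params) θ.ppSel P (gOfRecord₁₃ F N θ P) k s V := by
  show ∑ s, _ ≤ ∑ s, _
  exact Finset.sum_le_sum fun s _ => histTerm₁₃_le_histTermT_of_liveSel θ hζu hζa hsel P k s V

/-- **Termwise EQUALITY at every level at a history with EMPTY fibre bond set** (`Z′(s) = ∅`; §1: the all-small history). [cite: Balaban1989LargeFieldI, (0.3) p.176 and p.177 (i)–(ii); Balaban1988Convergent, (2.18) p.257] -/
theorem histTerm₁₃_eq_histTermT_of_fibOfSeq_eq_empty_of_liveSel (hζu : IsZetaUnity F N θ.ν θ.τ9.M θ.ζ) (hζa : IsZetaAbsLeOne F N θ.ν θ.τ9.M θ.ζ)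
    (hsel : θ.ppSel = ppSelLiveOfRecord F N θ.ν θ.τ9 (EOfRecord₁₃ F N θ) (wOfRecord₉ F N θ.toStage9Params)) (P : B12.RunParams) :
    ∀ (k : ℕ) {s : SeqOfRecord F θ.ν θ.τ9.M (gOfRecord₁₃ F N θ P) P.K k}, fibOfSeq F θ.ν θ.τ9 P (gOfRecord₁₃ F N θ P) k s = ∅ →
      ∀ V : GaugeField (F.P P.K) k (SU N),
        chiSeqOfRecord F N θ.ν θ.τ9.M (gOfRecord₁₃ F N θ P) P.K k s V *
            slotsOfRecord F N θ.ν θ.τ9 (EOfRecord₁₃ F N θ) (wOfRecord₉ F N θ.toStage9Params) θ.ppSel P (gOfRecord₁₃ F N θ P) k s V =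
          chiSeqOfRecord F N θ.ν θ.τ9.M (gOfRecord₁₃ F N θ P) P.K k s V *
            slotsTOfRecord F N θ.ν θ.τ9 (EOfRecord₁₃ F N θ) (wOfRecord₉ F N θ.toStage9Params) θ.ppSel P (gOfRecord₁₃ F N θ P) k s V
  | 0, _, _, _ => rfl
  | k + 1, _, hfib, V => histTerm₁₃_succ_eq_histTermT_of_fibOfSeq_eq_empty_of_liveSel θ hζu hζa hsel P k hfib V

/-- **The PRE-𝐑 term of an empty-fibre history is a lower bound for `ρ_k`, at every level and field** (that term is unchanged by 𝐑; every other term is `≥ 0`).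
[cite: Balaban1988Convergent, (2.18) p.257, Cor. 3 (2.50) p.264; Balaban1989LargeFieldI, (0.3) p.176 and p.177 (i)–(ii)] -/
theorem histTermT₁₃_le_densOfRecord₁₃_of_fibOfSeq_eq_empty_of_liveSel (hζu : IsZetaUnity F N θ.ν θ.τ9.M θ.ζ) (hζa : IsZetaAbsLeOne F N θ.ν θ.τ9.M θ.ζ)
    (hsel : θ.ppSel = ppSelLiveOfRecord F N θ.ν θ.τ9 (EOfRecord₁₃ F N θ) (wOfRecord₉ F N θ.toStage9Params)) (P : B12.RunParams) (k : ℕ)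
    {s₀ : SeqOfRecord F θ.ν θ.τ9.M (gOfRecord₁₃ F N θ P) P.K k} (hfib : fibOfSeq F θ.ν θ.τ9 P (gOfRecord₁₃ F N θ P) k s₀ = ∅)
    (V : GaugeField (F.P P.K) k (SU N)) :
    chiSeqOfRecord F N θ.ν θ.τ9.M (gOfRecord₁₃ F N θ P) P.K k s₀ V *
        slotsTOfRecord F N θ.ν θ.τ9 (EOfRecord₁₃ F N θ) (wOfRecord₉ F N θ.toStage9Params) θ.ppSel P (gOfRecord₁₃ F N θ P) k s₀ V ≤
      densOfRecord₁₃ F N θ P k V := by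
  rw [← histTerm₁₃_eq_histTermT_of_fibOfSeq_eq_empty_of_liveSel θ hζu hζa hsel P k hfib V]
  show _ ≤ ∑ s, _
  exact Finset.single_le_sum (f := fun s => chiSeqOfRecord F N θ.ν θ.τ9.M (gOfRecord₁₃ F N θ P) P.K k s V *
      slotsOfRecord F N θ.ν θ.τ9 (EOfRecord₁₃ F N θ) (wOfRecord₉ F N θ.toStage9Params) θ.ppSel P (gOfRecord₁₃ F N θ P) k s V)
    (fun s _ => mul_nonneg (chiSeqOfRecord_nonneg F N θ.ν θ.τ9.M _ P.K k s V)
      (slotsOfRecord_nonneg F N θ.ν θ.τ9 (EOfRecord₁₃ F N θ) (wOfRecord₉_nonneg θ hζu hζa) θ.ppSel P _ k s V)) (Finset.mem_univ s₀)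

end Record

/-! ## §3 THE (UV₁₃) ROW FROM (U1)ᵀ + (U2) + (L2ˢ)ᵀ — numbers form and the engines' binder -/

section UVRow

/-- **THE (UV₁₃) ROW AT ONE `(P, k)`, UNGUARDED, FROM 𝐓-IMAGE LEAVES** at a live-selector `Stage13Params` with the ζ-laws and `εreg` in [Av] Prop. 2's range: termwise majorants
`χ_k(s)(V)·slotT_k(s)(V) ≤ major s` at every `V`, their budget `Σ major ≤ exp(ep·|T|)`, and on the small locus the lower bound on the PRE-𝐑 term of one history `s₀` with
`Z′(s₀) = ∅` ⟹ the two-sided bound at EVERY `U` (p595529's `uv₁₃_of_upper_of_lowerSmallLocus` ∘ §2). [cite: Balaban1989LargeFieldII, (0.1) pp.355–356; Balaban1988Convergent, Cor. 3 (2.50) p.264, (3.24)–(3.25) p.270; Balaban1989LargeFieldI, (0.3) p.176, p.177 (i)–(ii); Balaban1985Averaging, Prop. 2 (54) p.26] -/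
theorem uv₁₃_of_U1T_U2_L2Tsmall_of_liveSel (θ : Stage13Params F N) (hζu : IsZetaUnity F N θ.ν θ.τ9.M θ.ζ) (hζa : IsZetaAbsLeOne F N θ.ν θ.τ9.M θ.ζ)
    (hsel : θ.ppSel = ppSelLiveOfRecord F N θ.ν θ.τ9 (EOfRecord₁₃ F N θ) (wOfRecord₉ F N θ.toStage9Params))
    (hε : 0 < θ.ν.εreg) (hε3 : (143 * ((((4 + 4 : ℕ) : ℝ)) ^ 2 / 4) ^ 2) * θ.ν.εreg ≤ 1 / 3)
    (hε2 : 2 * θ.ν.εreg ≤ 2 * deltaSU (Fin N) / ((((4 + 4) * F.L : ℕ) : ℝ) ^ 2))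
    (P : B12.RunParams) {k : ℕ} (hk : k ≤ P.K) (em ep : ℝ)
    (major : SeqOfRecord F θ.ν θ.τ9.M (gOfRecord₁₃ F N θ P) P.K k → ℝ)
    {s₀ : SeqOfRecord F θ.ν θ.τ9.M (gOfRecord₁₃ F N θ P) P.K k} (hfib : fibOfSeq F θ.ν θ.τ9 P (gOfRecord₁₃ F N θ P) k s₀ = ∅)
    (hU1T : ∀ s (V : GaugeField (F.P P.K) k (SU N)), chiSeqOfRecord F N θ.ν θ.τ9.M (gOfRecord₁₃ F N θ P) P.K k s V *
        slotsTOfRecord F N θ.ν θ.τ9 (EOfRecord₁₃ F N θ) (wOfRecord₉ F N θ.toStage9Params) θ.ppSel P (gOfRecord₁₃ F N θ P) k s V ≤ major s)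
    (hU2 : ∑ s, major s ≤ Real.exp (ep * (Fintype.card (Site (F.P P.K) k) : ℝ)))
    (hL2Tsmall : ∀ U : GaugeField (F.P P.K) k (SU N),
      (∀ q : Plaq (F.P P.K) k, ¬ IsB0 (F := F) (⟨q.src, q.μ⟩ : PBond (F.P P.K) k) → ¬ IsB0 (F := F) (⟨q.src.shift q.μ, q.ν⟩ : PBond (F.P P.K) k) →
        ¬ IsB0 (F := F) (⟨q.src.shift q.ν, q.μ⟩ : PBond (F.P P.K) k) → ¬ IsB0 (F := F) (⟨q.src, q.ν⟩ : PBond (F.P P.K) k) →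
        dist1 (GaugeField.plaqHol U q) < 2 * θ.ν.εreg + 4 * θ.ε₂₉) →
      chiβOfRecord₁₃ F N θ P.K (gOfRecord₁₃ F N θ P) k U *
          Real.exp (-(1 / (gOfRecord₁₃ F N θ P k) ^ 2 * wilsonBGOfRecord F N θ.εbg P k U) - em * (Fintype.card (Site (F.P P.K) k) : ℝ)) ≤
        chiSeqOfRecord F N θ.ν θ.τ9.M (gOfRecord₁₃ F N θ P) P.K k s₀ U *
          slotsTOfRecord F N θ.ν θ.τ9 (EOfRecord₁₃ F N θ) (wOfRecord₉ F N θ.toStage9Params) θ.ppSel P (gOfRecord₁₃ F N θ P) k s₀ U)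
    (U : GaugeField (F.P P.K) k (SU N)) :
    chiβOfRecord₁₃ F N θ P.K (gOfRecord₁₃ F N θ P) k U *
          Real.exp (-(1 / (gOfRecord₁₃ F N θ P k) ^ 2 * wilsonBGOfRecord F N θ.εbg P k U) - em * (Fintype.card (Site (F.P P.K) k) : ℝ)) ≤
        densOfRecord₁₃ F N θ P k U ∧
      densOfRecord₁₃ F N θ P k U ≤ Real.exp (ep * (Fintype.card (Site (F.P P.K) k) : ℝ)) :=
  uv₁₃_of_upper_of_lowerSmallLocus θ hζu hζa hε hε3 hε2 P hk em ep
    (fun V => (densOfRecord₁₃_le_sum_histTermT_of_liveSel θ hζu hζa hsel P k V).trans ((Finset.sum_le_sum fun s _ => hU1T s V).trans hU2))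
    (fun V hsmall => (hL2Tsmall V hsmall).trans (histTermT₁₃_le_densOfRecord₁₃_of_fibOfSeq_eq_empty_of_liveSel θ hζu hζa hsel P k hfib V)) U

/-- **★★ THE ENGINES' `hUV` BINDER, VERBATIM, FROM (U1)ᵀ + (U2) + (L2ˢ)ᵀ ON THE 𝐓-IMAGE** — the 𝐑-free twin of p597573's `hUV₁₃CoPH_of_U1_U2_L2small` (engines' keying: a
history-indexed `θ : Stage13HParams` under its CORE provisos `Provisos₁₃CoPH`, whose Stage-13 part carries K0a's live selector — `hsel`, `rfl` at every door
`Stage13HParams.ofHistoryBlind ⟨θ₁₅ᶜᶜᴹᵂ, Zr⟩`; a world `w`; `εreg` in [Av] Prop. 2's range): termwise majorants `major P k s` of the PRE-𝐑 terms `χ_k(s)·slotT_k(s)` and their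
budget `≤ exp(w.ep(g_k)|T₁^{(k)}|)` at every `V`, and the all-small history's lower bound `χβ_k·exp(−g_k⁻²A^η_k − w.em(g_k)|T₁^{(k)}|) ≤ χ_k(s₀)·slotT_k(s₀)` demanded ONLY on
the small locus, at a chosen index `s₀ P k` whose last small-field region is everything (`hΛ`; hence `Z′ = ∅`, §1) — all three guarded by the window and `SLaw₁₃CoPH`
exactly as `hUV` is.  The conclusion is the `hUV` hypothesis of dag-n12-d's `nodes₁₃CoPH_upS_fourPinW₀_pointed` ∕ dag-n24-c's children-split closers LETTER FOR LETTER.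
NO statement about def-R's 𝐑-operation is an input. [cite: Balaban1989LargeFieldII, Thm 1 p.355, (0.1) pp.355–356; Balaban1988Convergent, (2.18) p.257, Cor. 3 (2.50) p.264, (3.24)–(3.25) p.270; Balaban1989LargeFieldI, (0.3) p.176, p.177 (i)–(ii); Balaban1987RG1, (2.9) p.266; Balaban1985Averaging, Prop. 2 (54) p.26] -/
theorem hUV₁₃CoPH_of_U1T_U2_L2Tsmall_of_liveSel (θ : Stage13HParams F N) (h : θ.Provisos₁₃CoPH F N)
    (hsel : θ.ppSel = ppSelLiveOfRecord F N θ.ν θ.τ9 (EOfRecord₁₃ F N θ.toStage13Params) (wOfRecord₉ F N θ.toStage9Params)) (w : WorldP)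
    (hε : 0 < θ.ν.εreg) (hε3 : (143 * ((((4 + 4 : ℕ) : ℝ)) ^ 2 / 4) ^ 2) * θ.ν.εreg ≤ 1 / 3)
    (hε2 : 2 * θ.ν.εreg ≤ 2 * deltaSU (Fin N) / ((((4 + 4) * F.L : ℕ) : ℝ) ^ 2))
    (major : (P : B12.RunParams) → (k : ℕ) → SeqOfRecord F θ.ν θ.τ9.M (gOfRecord₁₃ F N θ.toStage13Params P) P.K k → ℝ)
    (s₀ : (P : B12.RunParams) → (k : ℕ) → SeqOfRecord F θ.ν θ.τ9.M (gOfRecord₁₃ F N θ.toStage13Params P) P.K k)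
    (hΛ : ∀ (P : B12.RunParams) (k : ℕ), (s₀ P k).Λ k = Set.univ)
    (hU1T : ∀ P : B12.RunParams, (genFlow (betaOfRecord₁₃ F N θ.toStage13Params) P.g0).InInterval w.γ P.K → ∀ k, k ≤ P.K → SLaw₁₃CoPH F N θ P k →
      ∀ s V, chiSeqOfRecord F N θ.ν θ.τ9.M (gOfRecord₁₃ F N θ.toStage13Params P) P.K k s V *
        slotsTOfRecord F N θ.ν θ.τ9 (EOfRecord₁₃ F N θ.toStage13Params) (wOfRecord₉ F N θ.toStage9Params) θ.ppSel P (gOfRecord₁₃ F N θ.toStage13Params P) k s V ≤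
          major P k s)
    (hU2 : ∀ P : B12.RunParams, (genFlow (betaOfRecord₁₃ F N θ.toStage13Params) P.g0).InInterval w.γ P.K → ∀ k, k ≤ P.K → SLaw₁₃CoPH F N θ P k →
      ∑ s, major P k s ≤ Real.exp (w.ep (gOfRecord₁₃ F N θ.toStage13Params P k) * (Fintype.card (Site (F.P P.K) k) : ℝ)))
    (hL2Tsmall : ∀ P : B12.RunParams, (genFlow (betaOfRecord₁₃ F N θ.toStage13Params) P.g0).InInterval w.γ P.K → ∀ k, k ≤ P.K → SLaw₁₃CoPH F N θ P k →
      ∀ V : GaugeField (F.P P.K) k (SU N),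
        (∀ q : Plaq (F.P P.K) k, ¬ IsB0 (F := F) (⟨q.src, q.μ⟩ : PBond (F.P P.K) k) → ¬ IsB0 (F := F) (⟨q.src.shift q.μ, q.ν⟩ : PBond (F.P P.K) k) →
          ¬ IsB0 (F := F) (⟨q.src.shift q.ν, q.μ⟩ : PBond (F.P P.K) k) → ¬ IsB0 (F := F) (⟨q.src, q.ν⟩ : PBond (F.P P.K) k) →
          dist1 (GaugeField.plaqHol V q) < 2 * θ.ν.εreg + 4 * θ.ε₂₉) →
        chiβOfRecord₁₃ F N θ.toStage13Params P.K (gOfRecord₁₃ F N θ.toStage13Params P) k V *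
            Real.exp (-(1 / (gOfRecord₁₃ F N θ.toStage13Params P k) ^ 2 * wilsonBGOfRecord F N θ.εbg P k V)
              - w.em (gOfRecord₁₃ F N θ.toStage13Params P k) * (Fintype.card (Site (F.P P.K) k) : ℝ)) ≤
          chiSeqOfRecord F N θ.ν θ.τ9.M (gOfRecord₁₃ F N θ.toStage13Params P) P.K k (s₀ P k) V *
            slotsTOfRecord F N θ.ν θ.τ9 (EOfRecord₁₃ F N θ.toStage13Params) (wOfRecord₉ F N θ.toStage9Params) θ.ppSel P
              (gOfRecord₁₃ F N θ.toStage13Params P) k (s₀ P k) V) :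
    ∀ P : B12.RunParams, (genFlow (betaOfRecord₁₃ F N θ.toStage13Params) P.g0).InInterval w.γ P.K → ∀ k, k ≤ P.K → SLaw₁₃CoPH F N θ P k →
      ∀ U : GaugeField (F.P P.K) k (SU N),
        chiβOfRecord₁₃ F N θ.toStage13Params P.K (gOfRecord₁₃ F N θ.toStage13Params P) k U *
              Real.exp (-(1 / (gOfRecord₁₃ F N θ.toStage13Params P k) ^ 2 * wilsonBGOfRecord F N θ.toStage13Params.εbg P k U)
                - w.em (gOfRecord₁₃ F N θ.toStage13Params P k) * (Fintype.card (Site (F.P P.K) k) : ℝ)) ≤ densOfRecord₁₃ F N θ.toStage13Params P k U ∧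
        densOfRecord₁₃ F N θ.toStage13Params P k U ≤ Real.exp (w.ep (gOfRecord₁₃ F N θ.toStage13Params P k) * (Fintype.card (Site (F.P P.K) k) : ℝ)) :=
  hUV₁₃_of_upper_of_lowerSmallLocus θ h w hε hε3 hε2
    (fun P hP k hk hS U =>
      (densOfRecord₁₃_le_sum_histTermT_of_liveSel θ.toStage13Params h.zetaUnity h.zetaAbs hsel P k U).trans
        ((Finset.sum_le_sum fun s _ => hU1T P hP k hk hS s U).trans (hU2 P hP k hk hS)))
    (fun P hP k hk hS U hsmall =>
      (hL2Tsmall P hP k hk hS U hsmall).trans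
        (histTermT₁₃_le_densOfRecord₁₃_of_fibOfSeq_eq_empty_of_liveSel θ.toStage13Params h.zetaUnity h.zetaAbs hsel P k
          (fibOfSeq_eq_empty_of_Λ_eq_univ θ.ν θ.τ9 P _ k (s₀ P k) (hΛ P k)) U))

end UVRow

end Summit.QuantumFields.YangMills.BalabanUVNodes.N13UVRowOfU1TU2L2TSmallLocus

end
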